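import Literature.AlgebraicGeometry.HodgeTheory.HyperplaneClassLine
import Literature.AlgebraicGeometry.HodgeTheory.KaehlerClass
import Literature.AlgebraicGeometry.Motives.HodgeRiemannBilinearDischarge
import Literature.AlgebraicGeometry.Motives.HyperbolicWeilType
import Literature.AlgebraicTopology.SingularHomology.CupProductProofs
import HarnessLib

/-!
# The Hodge–Riemann bilinear relation in degree one for the hyperplane class, as a class identity with a rational top class

Family `hodge`, layer `Literature/AlgebraicGeometry/HodgeTheory`. Theorems only. The main result
`hodgeRiemann_degreeOne` is C. Voisin, *Hodge Theory and Complex Algebraic Geometry I*, Thm. 6.32 at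
`k = 1`, `(p,q) = (1,0)`, with §7.1.2–7.1.3, on the summit carriers `complexBetti X k = Hᵏ(X(ℂ); ℂ)`
and in the RATIONAL, CLASS-IDENTITY form: for `X ⊂ ℙᴺ` smooth projective of dimension `d + 1`
(every `d ≥ 0`, curves included), `h = ι^* a` the pull-back of a non-zero rational class of
`H²(ℙᴺ(ℂ); ℂ)` and ANY Hodge model `A`, there is a non-zero RATIONAL top class
`ω₀ ∈ H^{2+2d}(X(ℂ); ℂ)` with **`i · hᵈ ⌣ (x ⌣ x̄) = t · ω₀`, `t > 0`, for every non-zero class `x`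
of type `(1,0)`** (`hᵈ ⌣ (x ⌣ x̄) = Q_{h,d}(x, x̄)`, the polarization pairing
`Motives.polarizationPairingOne` of `Motives/HyperbolicWeilType`). This was the statement of the
former named fact `hodgeRiemann_degreeOne` of `HodgeTheory/HodgeRiemannDegreeOne` (filed 2026-08-16,
since replaced there by the functional form `IsKaehlerClass.hodgeRiemann_one_smul`: a positive linear
functional `τ` on `H^{1+(1+2m)}`, `m ≥ 1`); it is the exact HYPOTHESIS SHAPE of the summit-side
signature computation (`Summits/…/HeckePrymWeilWeilTwelvefoldsSqrtMinus7WeilSignature`), i.e. the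
Hodge-theoretic input — the SIGN in degree one — of the signature `(n, n)` of the Hermitian form of a
polarized abelian variety of Weil type (B. van Geemen, LNM 1594, Lemma 5.2 (4)–(5)), consumed by the
aiming half of the product trick (`Motives.exists_cmWeilSurface_aimedSplitProduct_of_ne_one_of_ne_three`).
Compared with `IsKaehlerClass.hodgeRiemann_one_smul` it fixes ONE rational reference class `ω₀`
(so the positivity is a statement inside the rational structure, as van Geemen uses it), needs no
harmonic theory, and includes `d = 0`.

## Proof (the printed one, Voisin I §6.3.2 / Huybrechts Prop. 3.3.15 at `k = 1`, and §7.1.2)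

Fix a natural, multiplicative, normalised real de Rham comparison `e` on the manifolds charted on the
model space of `A` (de Rham's theorem, `exists_deRhamIsoFamily_holds`) and replace the comparison of
`A` by `e ⊗ ℂ` (the model `B`; Hodge types do not depend on the model,
`hodgePQ_independent_of_hodgeModel_holds` — the pattern of `cupPreservesHodgeType_of_exists_deRhamIsoFamily`).
Let `g` be the Kähler metric of `X^an` whose Kähler form is the restricted Fubini–Study form `θ` of
`ι` (`HodgeModel.exists_isKaehler_kaehlerForm_eq_fubiniStudyPullbackForm`, Voisin I §3.3.2), `H` the
hyperplane-type class, `B^* H = e[θ] ⊗ 1 =: Θ`; then `ι^* a = s · H` with `s ∈ ℝ^×`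
(`exists_real_map_eq_smul_of_pullback_eq_fubiniStudy`, §7.1.2 / Thm. 7.10).

* **Degree one needs no harmonic theory.** A class `x` of type `(1,0)` is `B^* x = (e ⊗ ℂ)[α]` for ONE
  closed `(1,0)`-form `α` (`exists_eq_mk_of_mem_hodgePQ`), and `α ∧ ω^{d+1} = 0` identically (a form
  of degree `2d + 3` on a manifold of real dimension `2d + 2`, `mform_eq_zero_of_finrank_lt`), so the
  POINTWISE Hodge–Riemann relation (Huybrechts Cor. 1.2.36, the tree's `Motives.hodgeRiemann_pointwise`)
  applies at every point: `i (α ∧ ᾱ ∧ ωᵈ)_y = c(y) (ω^{d+1})_y`, `c ≥ 0`, `c(y) > 0` where `α_y ≠ 0`.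
  Integrating against the complex orientation (the constant orientation of
  `Motives.exists_orientation_integral_kaehlerFormPow_pos`, pinned by `∫ ω^{d+1} > 0` on the connected
  `X^an`, `Motives.sign_mul_apply_pos_of_integral_pos`) gives `i ∫ α ∧ ᾱ ∧ ωᵈ > 0`
  (`integral_pos_of_pointwise_of_isOfType` — verbatim the integration half of
  `Motives.hodge_riemann_bilinear_of_pointwise`, for a form only assumed smooth of type `(p,q)`).
  (The general-degree statement through harmonic representatives is the sibling
  `hodgeRiemann_primitiveClass`, file `HodgeRiemannPrimitiveClasses`.)
* **Integration descends to top cohomology**, which is a line: `∫` vanishes on exact complex top forms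
  (Stokes, `MForm.integral_eq_zero_of_mem_exactSmoothForms_holds`, on real and imaginary parts),
  `H^{2d+2}_dR(X^an; ℂ) ≅ H^{2d+2}(X(ℂ); ℂ)` is one-dimensional (`finrank_complexBetti_two_mul_eq_one`)
  and spanned by `[ω^{d+1}]` (`∫ ω^{d+1} > 0`), so `i [α ∧ ᾱ ∧ ωᵈ] = t [ω^{d+1} ⊗ 1]` with
  `t = i ∫ α ∧ ᾱ ∧ ωᵈ / ∫ ω^{d+1} > 0`.
* **Transport.** `e ⊗ ℂ` is multiplicative on closed complex forms (`complexifyFun_mk_wedge`, Warner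
  Thm. 5.45) and real (`conjClass_complexifyFun`), `e[ωᵖ] ⊗ 1 = Θᵖ`
  (`HodgeModel.cupPowTwo_ofRealClass_kaehlerClass`, and `e[1] = 1`, `1 ⊗ 1 = 1` for `p = 0`), and
  `Lᵈ_Θ y = y ⌣ Θᵈ` (associativity and graded commutativity of `⌣`, Hatcher §3.2), so the identity
  reads `i · Lᵈ_Θ (u ⌣ ū) = t · Lᵈ_Θ Θ`, `u = B^* x`, on `X^an`, and descends along the injective,
  multiplicative `B^*` (naturality of `⌣`, `L` and `conj`) to `i · Q_{H,d}(x, x̄) = t · Lᵈ_H H` on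
  `X(ℂ)`. Finally `Q_{sH,d} = sᵈ Q_{H,d}`, `Lᵈ_{sH}(sH) = s^{d+1} Lᵈ_H H`, `Lᵈ_H H ≠ 0` (the powers of
  a Kähler class, Voisin I Cor. 3.9, `IsKaehlerClassVia.cupPowTwo_ne_zero`): `ω₀ = ± Lᵈ_h h`
  according to the sign of `s`, a rational class, and `t' = t / |s|`.

Everything is proved; no definition and no named fact is introduced (D-0026). Helper lemmas live in
the grouping namespace `HodgeRiemannDegreeOne`. Also recorded: the model-independent corollary
`hodgeRiemann_degreeOne_of_isOfHodgeType` (hypothesis `IsOfHodgeType (d+1) X 1 1 0 x`).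

## References

* [VoisinHodgeI2002] C. Voisin, Hodge Theory and Complex Algebraic Geometry I (CUP 2002), §3.1.3
  Cor. 3.9, §3.3.2, §5.3.2 Thm. 5.29, §6.1.3 Cor. 6.12, §6.2.3, §6.3.2 Thm. 6.32, §7.1.2, Thm. 7.10.
* [Huybrechts2005] D. Huybrechts, Complex Geometry (Springer 2005), Cor. 1.2.36, Prop. 3.3.15.
* [vanGeemen1994HodgeAV] B. van Geemen, An introduction to the Hodge conjecture for abelian
  varieties, LNM 1594 (1994), Lemma 5.2 (4)–(5).
* [WarnerGTM94] F. W. Warner, Foundations of Differentiable Manifolds and Lie Groups, 4.8, Thm. 4.9,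
  Thm. 5.45.
* [HatcherAT2002] A. Hatcher, Algebraic Topology (CUP 2002), §3.2 p. 211, Prop. 3.10, Thm. 3.11.
* [LeeSmoothManifolds2013] J. M. Lee, Introduction to Smooth Manifolds, 2nd ed., Prop. 16.6.
-/

noncomputable section

open scoped Manifold ContDiff Topology ComplexConjugate
open CategoryTheory AlgebraicGeometry

namespace Literature.AlgebraicGeometry.HodgeTheory

namespace HodgeRiemannDegreeOne

/-! ### Cup-product algebra: Lefschetz iterates as cup powers -/

section CupAlgebra

open Literature.AlgebraicTopology.SingularHomology Literature.Geometry.Kaehler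

variable {Y : Type} [TopologicalSpace Y]

/-- `Lʲ_κ y = κʲ ⌣ y` (the Lefschetz operator is cup product with `κ` on the left; associativity
and graded commutativity in even degree). [cite: HatcherAT2002, §3.2 p. 211 and Thm. 3.11] -/
theorem lefschetzPow_eq_cupPowTwo_cupProduct (κ : singularCohomology ℂ ℂ Y 2) (j k : ℕ)
    (y : singularCohomology ℂ ℂ Y k) :
    lefschetzPow κ j k y = cupProduct (by omega) (cupPowTwo κ j) y := by
  induction j with
  | zero => exact (one_cupProduct y).symm
  | succ j ih =>
    rw [lefschetzPow_succ, LinearMap.comp_apply, ih, lefschetzOperator_apply, cupPowTwo_succ]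
    -- `κ ⌣ (κʲ ⌣ y) = (κ ⌣ κʲ) ⌣ y = (κʲ ⌣ κ) ⌣ y`
    rw [← cupProduct_assoc (two_add_two_mul j) (by omega : 2 * j + k = k + 2 * j) (by omega) (by omega) κ
      (cupPowTwo κ j) y]
    congr 1
    rw [cupProduct_gradedComm_holds ℂ Y (two_add_two_mul j) (two_mul_add_two j) κ (cupPowTwo κ j)]
    simp

/-- `κʲ ⌣ y = y ⌣ κʲ`: classes of even degree are central. [cite: HatcherAT2002, Thm. 3.11] -/
theorem cupPowTwo_cupProduct_comm (κ : singularCohomology ℂ ℂ Y 2) (j k m : ℕ) (h : 2 * j + k = m)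
    (h' : k + 2 * j = m) (y : singularCohomology ℂ ℂ Y k) :
    cupProduct h (cupPowTwo κ j) y = cupProduct h' y (cupPowTwo κ j) := by
  rw [cupProduct_gradedComm_holds ℂ Y h h' (cupPowTwo κ j) y]
  simp [pow_mul]

/-- `Lʲ_κ y = y ⌣ κʲ`. [cite: HatcherAT2002, §3.2 p. 211 and Thm. 3.11] -/
theorem lefschetzPow_eq_cupProduct_cupPowTwo (κ : singularCohomology ℂ ℂ Y 2) (j k : ℕ)
    (y : singularCohomology ℂ ℂ Y k) :
    lefschetzPow κ j k y = cupProduct rfl y (cupPowTwo κ j) := by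
  rw [lefschetzPow_eq_cupPowTwo_cupProduct, cupPowTwo_cupProduct_comm]

/-- `Lʲ_κ κ = κʲ ⌣ κ`, the `(j+1)`-st cup power read in degree `2 + 2j`. [cite: HatcherAT2002, §3.2] -/
theorem lefschetzPow_self_eq_cupPowTwo (κ : singularCohomology ℂ ℂ Y 2) (j : ℕ) :
    lefschetzPow κ j 2 κ = cupProduct (by omega) (cupPowTwo κ j) κ := by
  rw [lefschetzPow_eq_cupPowTwo_cupProduct]

/-- `Lʲ_κ y` is rational for `κ`, `y` rational (cup products of rational classes are rational).
[cite: HatcherAT2002, §3.2] -/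
theorem IsRationalClass.lefschetzPow {κ : singularCohomology ℂ ℂ Y 2} (hκ : IsRationalClass κ) (j : ℕ)
    {k : ℕ} {y : singularCohomology ℂ ℂ Y k} (hy : IsRationalClass y) :
    IsRationalClass (lefschetzPow κ j k y) := by
  rw [lefschetzPow_eq_cupPowTwo_cupProduct]
  exact (hκ.cupPowTwo j).cup _ hy

/-- `Lʲ_{c κ} = cʲ Lʲ_κ` (the cup product is bilinear). [cite: VoisinHodgeI2002, §6.2.3] -/
theorem lefschetzPow_smul_left (c : ℂ) (κ : singularCohomology ℂ ℂ Y 2) :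
    ∀ (j k : ℕ) (y : singularCohomology ℂ ℂ Y k), lefschetzPow (c • κ) j k y = c ^ j • lefschetzPow κ j k y
  | 0, k, y => by simp
  | j + 1, k, y => by
    rw [lefschetzPow_succ, lefschetzPow_succ, LinearMap.comp_apply, LinearMap.comp_apply,
      lefschetzPow_smul_left c κ j k y, lefschetzOperator_apply, lefschetzOperator_apply, map_smul,
      map_smul, LinearMap.smul_apply, smul_smul, pow_succ]

/-- `Lʲ_{c κ} (c κ) = c^{j+1} Lʲ_κ κ`. [cite: VoisinHodgeI2002, §6.2.3] -/
theorem lefschetzPow_smul_self (c : ℂ) (κ : singularCohomology ℂ ℂ Y 2) (j : ℕ) :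
    lefschetzPow (c • κ) j 2 (c • κ) = c ^ (j + 1) • lefschetzPow κ j 2 κ := by
  rw [lefschetzPow_smul_left, map_smul, smul_smul, ← pow_succ]

/-- `(u ⌣ v) ⌣ w = u ⌣ (v ⌣ w)` for degree-one `u`, `v`, with a free target degree: the instance
`cupProduct_assoc rfl rfl hs hs' u v w` of `CupProduct.cupProduct_assoc`, deprecated in its favour
(no users left). [cite: HatcherAT2002, §3.2 p. 211] -/
@[deprecated cupProduct_assoc (since := "2026-08-16")]
theorem cupProduct_one_one_assoc (u v : singularCohomology ℂ ℂ Y 1) {m s : ℕ} (w : singularCohomology ℂ ℂ Y m)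
    (hs : 2 + m = s) (hs' : 1 + (1 + m) = s) :
    cupProduct hs (cupProduct (rfl : 1 + 1 = 2) u v) w = cupProduct hs' u (cupProduct rfl v w) :=
  cupProduct_assoc rfl rfl hs hs' u v w

end CupAlgebra



/-! ### Forms, complex de Rham classes and the complexified comparison -/

section OfRealOne

open Literature.AlgebraicTopology.SingularHomology

/-- `1 ⊗ 1 = 1`: complexification `H⁰(Y; ℝ) → H⁰(Y; ℂ)` maps the unit class to the unit class (both
are the constant cocycle `1`). [cite: HatcherAT2002, §3.2 p. 211] -/
theorem ofRealClass_one (Y : Type) [TopologicalSpace Y] :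
    ofRealClass Y 0 (singularCohomology.one ℝ Y) = singularCohomology.one ℂ Y := by
  rw [singularCohomology.one, ofRealClass_π, singularCohomology.one]
  congr 1
  refine singularCochainComplex.cocycles_ext ?_
  rw [coeffCocycle, AddMonoidHom.coe_mk, ZeroHom.coe_mk, singularCochainComplex.iCocycles_mk,
    singularCochainComplex.iCocycles_mk, singularCochainComplex.iCocycles_mk]
  refine singularCochainComplex.ext fun σ ↦ ?_
  rw [coeffCochain_apply]
  simp

end OfRealOne

section Forms

open Literature.AlgebraicTopology.SingularHomology Literature.Geometry.Kaehler
open Literature.NumberTheory.Transcendental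

universe u

variable {E : Type u} [NormedAddCommGroup E] [NormedSpace ℂ E]
  {M : Type u} [TopologicalSpace M] [ChartedSpace E M]

/-- A form of degree exceeding the real dimension of the model space vanishes (its arguments are
linearly dependent). [folklore] -/
theorem mform_eq_zero_of_finrank_lt [FiniteDimensional ℂ E] {F : Type*} [NormedAddCommGroup F]
    [NormedSpace ℝ F] {m : ℕ} (hm : Module.finrank ℝ E < m) (β : MForm 𝓘(ℝ, E) M F m) : β = 0 := by
  funext x
  ext v
  have hv : ¬ LinearIndependent ℝ v := fun h ↦ by
    have h' := h.fintype_card_le_finrank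
    rw [Fintype.card_fin] at h'
    exact absurd h' (not_le.2 hm)
  have h0 := AlternatingMap.map_linearDependent (β x).toAlternatingMap v hv
  rw [ContinuousAlternatingMap.coe_toAlternatingMap] at h0
  rw [h0]
  rfl

/-- A class of the span `H^{p,q}` is the class of ONE closed `(p,q)`-form (closed `(p,q)`-forms form a
subspace). Deprecated pointer to the canonical `Motives.exists_isOfType_mk_eq_of_mem_hodgePQ`
(`HodgeDecompositionHarmonicRepresentativeProofs.lean`; librarian dedup-02211, dedup-02431).
[cite: VoisinHodgeI2002, §6.1.3] -/
@[deprecated Motives.exists_isOfType_mk_eq_of_mem_hodgePQ (since := "2026-08-16")]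
theorem exists_eq_mk_of_mem_hodgePQ {k p q : ℕ} (hpq : p + q = k) {c : complexDeRhamCohomology E M k}
    (hc : c ∈ hodgePQ E M k p q) :
    ∃ α : cclosedSmoothForms E M k, IsOfType p q (α : MForm 𝓘(ℝ, E) M ℂ k) ∧
      complexDeRhamCohomology.mk E M k α = c :=
  Motives.exists_isOfType_mk_eq_of_mem_hodgePQ hpq hc

variable [IsManifold 𝓘(ℝ, E) ∞ M] [T2Space M] [SigmaCompactSpace M]

/-- **`(e ⊗ ℂ)[(α ∧ β).castDeg h] = (e ⊗ ℂ)[α] ⌣ (e ⊗ ℂ)[β]` in the cast degree** (the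
multiplicativity `complexifyFun_mk_wedge`, Voisin I Thm. 5.29 / Warner Thm. 5.45, along a degree
cast of forms). [cite: VoisinHodgeI2002, §5.3.2 Thm. 5.29] [cite: WarnerGTM94, Thm. 5.45] -/
theorem complexifyFun_mk_castDeg_wedge [WedgeFacts 𝓘(ℝ, E) M ℝ] [WedgeFacts 𝓘(ℝ, E) M ℂ]
    {e : DeRhamIsoFamily 𝓘(ℝ, E)} (he : e.IsMultiplicative) {k l m : ℕ} (h : k + l = m)
    (α : cclosedSmoothForms E M k) (β : cclosedSmoothForms E M l)
    (hγ : ((α : MForm 𝓘(ℝ, E) M ℂ k).wedge (β : MForm 𝓘(ℝ, E) M ℂ l)).castDeg h ∈ cclosedSmoothForms E M m) :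
    complexifyFun e m (complexDeRhamCohomology.mk E M m
        ⟨((α : MForm 𝓘(ℝ, E) M ℂ k).wedge (β : MForm 𝓘(ℝ, E) M ℂ l)).castDeg h, hγ⟩) =
      cupProduct h (complexifyFun e k (complexDeRhamCohomology.mk E M k α))
        (complexifyFun e l (complexDeRhamCohomology.mk E M l β)) := by
  subst h
  rw [← complexifyFun_mk_wedge he α β]
  rfl

/-- `(e ⊗ ℂ)[β ⊗ 1] = e[β] ⊗ 1` for a real closed form `β` (`complexifyFun_ofReal` on
representatives). [cite: VoisinHodgeI2002, §6.1.3 Cor. 6.12] -/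
theorem complexifyFun_mk_ofReal (e : DeRhamIsoFamily 𝓘(ℝ, E)) {k : ℕ}
    (β : closedSmoothForms 𝓘(ℝ, E) M ℝ k) (hβ : (β : MForm 𝓘(ℝ, E) M ℝ k).ofReal ∈ cclosedSmoothForms E M k) :
    complexifyFun e k (complexDeRhamCohomology.mk E M k ⟨(β : MForm 𝓘(ℝ, E) M ℝ k).ofReal, hβ⟩) =
      ofRealClass M k (e M k (deRhamCohomology.mk β)) := by
  rw [← complexifyFun_ofReal]
  congr 1


omit [IsManifold 𝓘(ℝ, E) ∞ M] [T2Space M] [SigmaCompactSpace M] in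
/-- Degree casts preserve closed smooth complex forms. [folklore] -/
theorem castDeg_mem_cclosedSmoothForms {k k' : ℕ} (h : k = k') {β : MForm 𝓘(ℝ, E) M ℂ k}
    (hβ : β ∈ cclosedSmoothForms E M k) : β.castDeg h ∈ cclosedSmoothForms E M k' := by
  subst h
  rw [MForm.castDeg_rfl]
  exact hβ

end Forms




/-! ### The Hodge–Riemann integral from the pointwise relation, for smooth `(p,q)`-forms -/

section Integral

open Bundle Module Set Filter Literature.Geometry.Kaehler Literature.NumberTheory.Transcendental
open Literature.AlgebraicGeometry.Motives

variable {E : Type*} [NormedAddCommGroup E] [NormedSpace ℂ E] [FiniteDimensional ℂ E]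
  {M : Type*} [TopologicalSpace M] [ChartedSpace E M]
  {n : ℕ} [Fact (finrank ℝ E = n)] [MeasurableSpace E] [BorelSpace E] [T2Space M]
  [IsManifold 𝓘(ℝ, E) ∞ M]
  (o : (x : M) → Orientation ℝ (TangentSpace 𝓘(ℝ, E) x) (Fin n))
  (g : ContMDiffRiemannianMetric 𝓘(ℝ, E) ∞ E (fun x : M ↦ TangentSpace 𝓘(ℝ, E) x))

/-- **The Hodge–Riemann integral inequality for a smooth `(p,q)`-form primitive against `ω`**, from
the pointwise relation — the integration half of Huybrechts's proof of Prop. 3.3.15, verbatim the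
argument of `Motives.hodge_riemann_bilinear_of_pointwise` but for a form which is only assumed
SMOOTH and OF TYPE `(p,q)` (no harmonicity: in degree one every closed `(1,0)`-form qualifies), and
for a CONTINUOUS orientation normalised by `∫_M ω^d > 0`. [cite: Huybrechts2005, Prop. 3.3.15] -/
theorem integral_pos_of_pointwise_of_isOfType [IsManifold 𝓘(ℂ, E) ω M] [CompactSpace M] [ConnectedSpace M]
    (ho : IsContinuousOrientation o) (hH : g.toRiemannianMetric.IsHermitian)
    {p q k r : ℕ} (h2d : 2 * finrank ℂ E = n) (h : k + (k + 2 * r) = n)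
    {α : MForm 𝓘(ℝ, E) M ℂ k} (hsα : IsSmoothForm α)
    (hpos : 0 < MForm.integral o ((kaehlerFormPow g.toRiemannianMetric (finrank ℂ E)).castDeg h2d))
    (hprim : α.wedge (kaehlerFormPow g.toRiemannianMetric (r + 1)).ofReal = 0) (hα0 : α ≠ 0)
    (hHR : ∀ (x : M),
      (α.wedge (kaehlerFormPow g.toRiemannianMetric (r + 1)).ofReal) x = 0 →
      ∃ c : ℝ, 0 ≤ c ∧ (α x ≠ 0 → 0 < c) ∧
        ((Complex.I ^ ((p : ℤ) - q) * (-1) ^ (k * (k - 1) / 2)) •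
            (α.wedge (α.conj.wedge (kaehlerFormPow g.toRiemannianMetric r).ofReal)).castDeg h) x =
          (c : ℂ) • ((kaehlerFormPow g.toRiemannianMetric (finrank ℂ E)).castDeg h2d).ofReal x) :
    0 < (Complex.I ^ ((p : ℤ) - q) * (-1) ^ (k * (k - 1) / 2) * cintegral o
          ((α.wedge (α.conj.wedge (kaehlerFormPow g.toRiemannianMetric r).ofReal)).castDeg h)).re ∧
      (Complex.I ^ ((p : ℤ) - q) * (-1) ^ (k * (k - 1) / 2) * cintegral o
          ((α.wedge (α.conj.wedge (kaehlerFormPow g.toRiemannianMetric r).ofReal)).castDeg h)).im = 0 := by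
  letI : RiemannianBundle (fun x : M ↦ TangentSpace 𝓘(ℝ, E) x) := ⟨g.toRiemannianMetric⟩
  classical
  haveI : IsContinuousRiemannianBundle E (fun x : M ↦ TangentSpace 𝓘(ℝ, E) x) :=
    ⟨g.inner, g.contMDiff.continuous, fun _ _ _ ↦ rfl⟩
  haveI : WedgeFacts 𝓘(ℝ, E) M ℝ :=
    wedgeFacts_of_assoc 𝓘(ℝ, E) M ℝ (ContinuousAlternatingMap.WedgeAssoc_holds ℝ E ℝ)
  haveI : WedgeFacts 𝓘(ℝ, E) M ℂ :=
    wedgeFacts_of_assoc 𝓘(ℝ, E) M ℂ (ContinuousAlternatingMap.WedgeAssoc_holds ℝ E ℂ)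
  have hω : isSmoothForm_kaehlerForm_of_isManifold_complex (E := E) (M := M) :=
    isSmoothForm_kaehlerForm_of_isManifold_complex_holds
  -- notation
  set C : ℂ := Complex.I ^ ((p : ℤ) - q) * (-1) ^ (k * (k - 1) / 2) with hC
  set γ : MForm 𝓘(ℝ, E) M ℂ n :=
    (α.wedge (α.conj.wedge (kaehlerFormPow g.toRiemannianMetric r).ofReal)).castDeg h with hγ
  set Ω : MForm 𝓘(ℝ, E) M ℝ n :=
    (kaehlerFormPow g.toRiemannianMetric (finrank ℂ E)).castDeg h2d with hΩ
  have hC0 : C ≠ 0 :=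
    mul_ne_zero (zpow_ne_zero _ Complex.I_ne_zero) (pow_ne_zero _ (neg_ne_zero.2 one_ne_zero))
  -- the pointwise relation
  have hpt : ∀ x : M, ∃ c : ℝ, 0 ≤ c ∧ (α x ≠ 0 → 0 < c) ∧ (C • γ) x = (c : ℂ) • Ω.ofReal x :=
    fun x ↦ hHR x (congr_fun hprim x)
  choose f hf0 hfpos hfeq using hpt
  -- the real top form `F = f · ω^d` and its identification with `C • γ`
  set F : MForm 𝓘(ℝ, E) M ℝ n := fun x ↦ f x • Ω x with hF
  have hre : (C • γ).re = F := by
    funext x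
    ext v
    rw [MForm.re_apply, hfeq x]
    simp [hF, MForm.ofReal_apply]
  have him : (C • γ).im = 0 := by
    funext x
    ext v
    rw [MForm.im_apply, hfeq x]
    simp [MForm.ofReal_apply]
  have hCγ : C • γ = F.ofReal := by
    rw [← MForm.ofReal_re_add_I_smul_ofReal_im (C • γ), hre, him, MForm.ofReal_zero, smul_zero,
      add_zero]
  have hγC : γ = C⁻¹ • F.ofReal := by
    rw [← hCγ, smul_smul, inv_mul_cancel₀ hC0, one_smul]
  -- smoothness of `F`
  have hsωr : IsSmoothForm (kaehlerFormPow g.toRiemannianMetric r) :=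
    isSmoothForm_kaehlerFormPow hω g r
  have hsγ : IsSmoothForm γ :=
    isSmoothForm_castDeg h (isSmoothForm_wedge hsα
      (isSmoothForm_wedge (isSmoothForm_conj hsα) hsωr.ofReal))
  have hsF : IsSmoothForm F := by
    rw [← hre]
    exact (hsγ.smul_complex C).re
  have hsΩ : IsSmoothForm Ω :=
    isSmoothForm_castDeg h2d (isSmoothForm_kaehlerFormPow hω g (finrank ℂ E))
  -- `ω^d` vanishes nowhere
  have hΩne : ∀ x : M, (show E [⋀^Fin n]→L[ℝ] ℝ from Ω x) (modelBasis E n) ≠ 0 := by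
    intro x hx
    have hzero := eq_zero_of_apply_modelBasis_eq_zero _ hx
    set e : Module.Basis (Fin (finrank ℂ E)) ℂ E := Module.finBasis ℂ E with he
    have hposF := kaehlerFormPow_apply_basisFrame_pos g.toRiemannianMetric hH x e
    set Fr : Fin (2 * finrank ℂ E) → E := fun i : Fin (2 * finrank ℂ E) ↦
      if (i : ℕ) % 2 = 0 then e ⟨(i : ℕ) / 2, by omega⟩
        else Complex.I • e ⟨(i : ℕ) / 2, by omega⟩ with hFr
    have hval : (show E [⋀^Fin n]→L[ℝ] ℝ from Ω x) (fun j ↦ Fr (Fin.cast h2d.symm j)) =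
        kaehlerFormPow g.toRiemannianMetric (finrank ℂ E) x Fr := by
      rw [hΩ]
      show (kaehlerFormPow g.toRiemannianMetric (finrank ℂ E)).castDeg h2d x _ = _
      rw [MForm.castDeg_apply]
      rfl
    have : (show E [⋀^Fin n]→L[ℝ] ℝ from Ω x) (fun j ↦ Fr (Fin.cast h2d.symm j)) = 0 := by
      rw [hzero]; rfl
    rw [hval] at this
    exact hposF.ne' this
  -- the orientation is the complex one at every point
  have hP : ∀ x : M, 0 < Real.sign (orientationForm o x (modelBasis E n)) *
      (show E [⋀^Fin n]→L[ℝ] ℝ from Ω x) (modelBasis E n) :=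
    sign_mul_apply_pos_of_integral_pos ho hsΩ hΩne hpos
  -- positivity of `∫ F`
  obtain ⟨x₀, hx₀⟩ : ∃ x₀ : M, α x₀ ≠ 0 := Function.ne_iff.1 hα0
  have hFapply : ∀ x : M, Real.sign (orientationForm o x (modelBasis E n)) *
      (show E [⋀^Fin n]→L[ℝ] ℝ from F x) (modelBasis E n) =
        f x * (Real.sign (orientationForm o x (modelBasis E n)) *
          (show E [⋀^Fin n]→L[ℝ] ℝ from Ω x) (modelBasis E n)) := fun x ↦ by
    have hFx : (show E [⋀^Fin n]→L[ℝ] ℝ from F x) (modelBasis E n) =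
        f x * (show E [⋀^Fin n]→L[ℝ] ℝ from Ω x) (modelBasis E n) := rfl
    rw [hFx]
    ring
  have hJ : 0 < F.integral o :=
    MForm.integral_pos_of_sign_mul_apply_nonneg ho hsF
      (fun x ↦ by rw [hFapply]; exact mul_nonneg (hf0 x) (hP x).le)
      ⟨x₀, by rw [hFapply]; exact mul_pos (hfpos x₀ hx₀) (hP x₀)⟩
  -- assemble
  have hint : C * cintegral o γ = (F.integral o : ℂ) := by
    rw [hγC, cintegral_smul_ofReal, ← mul_assoc, mul_inv_cancel₀ hC0, one_mul]
  have hint' : Complex.I ^ ((p : ℤ) - q) * (-1) ^ (k * (k - 1) / 2) * cintegral o γ =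
      (F.integral o : ℂ) := by rw [← hint]
  refine ⟨?_, ?_⟩
  · rw [hint', Complex.ofReal_re]; exact hJ
  · rw [hint', Complex.ofReal_im]


/-! ### The complex integral on smooth top forms and on top de Rham classes -/

/-- Additivity of the complex integral on smooth top forms. [cite: Warner1983, 4.8] -/
theorem cintegral_add' [CompactSpace M] [SigmaCompactSpace M] (ho : IsContinuousOrientation o)
    {α β : MForm 𝓘(ℝ, E) M ℂ n} (hα : IsSmoothForm α) (hβ : IsSmoothForm β) :
    cintegral o (α + β) = cintegral o α + cintegral o β := by
  apply Complex.ext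
  · rw [re_cintegral, Complex.add_re, re_cintegral, re_cintegral, MForm.re_add,
      MForm.integral_add_holds (o := o) ho hα.re hβ.re]
  · rw [im_cintegral, Complex.add_im, im_cintegral, im_cintegral, MForm.im_add,
      MForm.integral_add_holds (o := o) ho hα.im hβ.im]

/-- Homogeneity of the complex integral on smooth top forms. [cite: Warner1983, 4.8] -/
theorem cintegral_smul' [CompactSpace M] [SigmaCompactSpace M] (ho : IsContinuousOrientation o)
    (c : ℂ) {α : MForm 𝓘(ℝ, E) M ℂ n} (hα : IsSmoothForm α) :
    cintegral o (c • α) = c * cintegral o α := by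
  have hre : MForm.integral o (c • α).re = c.re * MForm.integral o α.re - c.im * MForm.integral o α.im := by
    rw [MForm.re_smul, sub_eq_add_neg, ← neg_one_smul ℝ (c.im • α.im),
      MForm.integral_add_holds (o := o) ho (hα.re.smul c.re) ((hα.im.smul c.im).smul (-1)),
      MForm.integral_smul, MForm.integral_smul, MForm.integral_smul]
    ring
  have him : MForm.integral o (c • α).im = c.re * MForm.integral o α.im + c.im * MForm.integral o α.re := by
    rw [MForm.im_smul, MForm.integral_add_holds (o := o) ho (hα.im.smul c.re) (hα.re.smul c.im),
      MForm.integral_smul, MForm.integral_smul]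
  apply Complex.ext
  · rw [re_cintegral, hre, Complex.mul_re, re_cintegral, im_cintegral]
  · rw [im_cintegral, him, Complex.mul_im, re_cintegral, im_cintegral]

/-- **Stokes for complex top forms**: an exact smooth complex top form integrates to zero on a
closed manifold (real and imaginary parts are exact real forms). [cite: Warner1983, Thm. 4.9] -/
theorem cintegral_eq_zero_of_mem_cexactSmoothForms [CompactSpace M] [SigmaCompactSpace M]
    (ho : IsContinuousOrientation o) {α : MForm 𝓘(ℝ, E) M ℂ n} (hα : α ∈ cexactSmoothForms E M n) :
    cintegral o α = 0 := by
  apply Complex.ext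
  · rw [re_cintegral, Complex.zero_re]
    exact MForm.integral_eq_zero_of_mem_exactSmoothForms_holds (o := o) ho (re_mem_exactSmoothForms hα)
  · rw [im_cintegral, Complex.zero_im]
    exact MForm.integral_eq_zero_of_mem_exactSmoothForms_holds (o := o) ho (im_mem_exactSmoothForms hα)

/-- **The complex integral on top de Rham classes**: if `[β] = z • [γ]` then `∫ β = z ∫ γ`.
[cite: Warner1983, 4.9] -/
theorem cintegral_eq_mul_of_mk_eq_smul [CompactSpace M] [SigmaCompactSpace M] (ho : IsContinuousOrientation o)
    (β γ : cclosedSmoothForms E M n) (z : ℂ)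
    (hz : complexDeRhamCohomology.mk E M n β = z • complexDeRhamCohomology.mk E M n γ) :
    cintegral o (β : MForm 𝓘(ℝ, E) M ℂ n) = z * cintegral o (γ : MForm 𝓘(ℝ, E) M ℂ n) := by
  have hβs : IsSmoothForm (β : MForm 𝓘(ℝ, E) M ℂ n) := ((mem_cclosedSmoothForms_iff _).1 β.2).1
  have hγs : IsSmoothForm (γ : MForm 𝓘(ℝ, E) M ℂ n) := ((mem_cclosedSmoothForms_iff _).1 γ.2).1
  have hex : (β : MForm 𝓘(ℝ, E) M ℂ n) - z • (γ : MForm 𝓘(ℝ, E) M ℂ n) ∈ cexactSmoothForms E M n := by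
    rw [← map_smul] at hz
    exact (complexDeRhamCohomology.mk_eq_mk_iff _ _).1 hz
  have h0 := cintegral_eq_zero_of_mem_cexactSmoothForms o ho hex
  have hsplit : (β : MForm 𝓘(ℝ, E) M ℂ n) =
      ((β : MForm 𝓘(ℝ, E) M ℂ n) - z • (γ : MForm 𝓘(ℝ, E) M ℂ n)) + z • (γ : MForm 𝓘(ℝ, E) M ℂ n) := by
    abel
  have hs1 : IsSmoothForm ((β : MForm 𝓘(ℝ, E) M ℂ n) - z • (γ : MForm 𝓘(ℝ, E) M ℂ n)) := by
    rw [sub_eq_add_neg, ← neg_one_smul ℂ (z • (γ : MForm 𝓘(ℝ, E) M ℂ n))]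
    exact hβs.add ((hγs.smul_complex z).smul_complex (-1))
  rw [hsplit, cintegral_add' o ho hs1 (hγs.smul_complex z), h0, zero_add, cintegral_smul' o ho z hγs]

end Integral





/-! ### Degree bookkeeping and the powers of the Kähler class -/

section Bookkeeping

open Bundle Module Literature.Geometry.Kaehler Literature.NumberTheory.Transcendental
open Literature.AlgebraicGeometry.Motives
open Literature.AlgebraicTopology.SingularHomology
open Literature.AlgebraicGeometry.Motives.AnalytificationKaehler (fubiniStudyPullbackForm)

universe u
variable {n : ℕ} {X : Motives.SchemeOver ℂ}

/-- Transfer of an identity `c • (a ⌣ b) = c' • (a' ⌣ b')` along an equality of target degrees (the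
target degree of `cupProduct` is a free name). [folklore] -/
theorem smul_cupProduct_eq_of_degree_eq {Y : Type} [TopologicalSpace Y] {p q p' q' s s' : ℕ}
    (h₁ : p + q = s) (h₂ : p' + q' = s) (h₁' : p + q = s') (h₂' : p' + q' = s')
    {a : singularCohomology ℂ ℂ Y p} {b : singularCohomology ℂ ℂ Y q}
    {a' : singularCohomology ℂ ℂ Y p'} {b' : singularCohomology ℂ ℂ Y q'} {c c' : ℂ}
    (H : c • cupProduct h₁ a b = c' • cupProduct h₂ a' b') :
    c • cupProduct h₁' a b = c' • cupProduct h₂' a' b' := by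
  have e : s = s' := h₁.symm.trans h₁'
  subst e
  exact H

/-- `a ⌣ b ≠ 0` is insensitive to the name of the target degree. [folklore] -/
theorem cupProduct_ne_zero_of_degree_eq {Y : Type} [TopologicalSpace Y] {p q s s' : ℕ}
    (h : p + q = s) (h' : p + q = s') {a : singularCohomology ℂ ℂ Y p} {b : singularCohomology ℂ ℂ Y q}
    (H : cupProduct h a b ≠ 0) : cupProduct h' a b ≠ 0 := by
  have e : s = s' := h.symm.trans h'
  subst e
  exact H

/-- **`e[ωᵖ] ⊗ 1 = Θᵖ`** for every `p`, `Θ = e[ω] ⊗ 1` the complexified Kähler class of a Hodge model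
(the case `p ≥ 1` is `HodgeModel.cupPowTwo_ofRealClass_kaehlerClass`, Warner Thm. 5.45; `p = 0` is the
normalisation `e[1] = 1` of the de Rham family and `1 ⊗ 1 = 1`). [cite: WarnerGTM94, Thm. 5.45]
[cite: VoisinHodgeI2002, §6.2.3] -/
theorem ofRealClass_kaehlerFormPow_eq_cupPowTwo (A : HodgeModel n X) (e : DeRhamIsoFamily 𝓘(ℝ, A.model))
    (hem : e.IsMultiplicative) (heu : e.IsNormalized)
    (hω : isSmoothForm_kaehlerForm_of_isManifold_complex (E := A.model) (M := A.carrier))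
    (g : ContMDiffRiemannianMetric 𝓘(ℝ, A.model) ∞ A.model (fun x : A.carrier ↦ TangentSpace 𝓘(ℝ, A.model) x))
    (hg : g.toRiemannianMetric.IsKaehler) (p : ℕ) :
    ofRealClass A.carrier (2 * p) (e A.carrier (2 * p) (deRhamCohomology.mk
        ⟨kaehlerFormPow g.toRiemannianMetric p, A.kaehlerFormPow_mem_closedSmoothForms g hg p⟩)) =
      cupPowTwo (ofRealClass A.carrier 2 (e A.carrier 2 (g.kaehlerClass hω hg))) p := by
  rcases Nat.eq_zero_or_pos p with rfl | hp
  · have h1 : (deRhamCohomology.mk ⟨kaehlerFormPow g.toRiemannianMetric 0,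
        A.kaehlerFormPow_mem_closedSmoothForms g hg 0⟩ : deRhamCohomology 𝓘(ℝ, A.model) A.carrier ℝ (2 * 0)) =
        deRhamCohomology.one 𝓘(ℝ, A.model) A.carrier ℝ := by
      unfold deRhamCohomology.one
      congr 1
    rw [h1, cupPowTwo_zero]
    exact (congrArg (ofRealClass A.carrier 0) (heu A.carrier)).trans (ofRealClass_one A.carrier)
  · exact (A.cupPowTwo_ofRealClass_kaehlerClass e hem hω g hg hp).symm


end Bookkeeping

end HodgeRiemannDegreeOne

/-! ### The main theorem -/

section Discharge

open Bundle Module Literature.Geometry.Kaehler Literature.NumberTheory.Transcendental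
open Literature.AlgebraicGeometry.Motives
open Literature.AlgebraicTopology.SingularHomology
open Literature.AlgebraicGeometry.Motives.AnalytificationKaehler (fubiniStudyPullbackForm)
open HodgeRiemannDegreeOne

set_option maxHeartbeats 800000 in
/-- **The Hodge–Riemann bilinear relation in degree one for the hyperplane class, rational
class-identity form** (Voisin I Thm. 6.32 at `k = 1`, `(p,q) = (1,0)`: `i ∫_X ω^{n-1} ∧ α ∧ ᾱ > 0` for
`0 ≠ α ∈ H^{1,0}(X)`, every degree-one class being primitive; `[ω] = [H]|_X` for `X ⊂ ℙᴺ`, §7.1.2 and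
Thm. 7.10). For `X` smooth projective of dimension `d + 1`, a projective embedding `ι`, a non-zero
rational `a ∈ H²(ℙᴺ(ℂ); ℂ)`, `h = ι^* a`, and any Hodge model `A`: with `ω₀ = ± Lᵈ_h h` (sign of the
real scalar `s`, `ι^* a = s · H`, `H` the hyperplane-type Kähler class), a non-zero rational class of
`H^{2d+2}(X(ℂ); ℂ)`, one has `i · hᵈ ⌣ (x ⌣ x̄) = t · ω₀` with `t > 0` for every non-zero `x` of type
`(1,0)`. Proof: module docstring (pointwise Hodge–Riemann at every point of a closed `(1,0)`-form,
integration against the complex orientation, Stokes, `H^{top}` a line, transport along `e ⊗ ℂ` and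
`B^*`). This is verbatim the statement of the former named fact `hodgeRiemann_degreeOne` (minus its
unused reality hypothesis on `A`). Relies on nothing unproved.
[cite: VoisinHodgeI2002, §6.3.2 Thm. 6.32, §7.1.2 and Thm. 7.10]
[cite: Huybrechts2005, Cor. 1.2.36 and Prop. 3.3.15] [cite: vanGeemen1994HodgeAV, Lemma 5.2 (4)–(5)] -/
theorem hodgeRiemann_degreeOne {d : ℕ} {X : Motives.SchemeOver ℂ}
    (hX : Motives.IsSmoothProjective (d + 1) X) (emb : Motives.ProjectiveEmbedding X)
    {a : complexBetti (Motives.projectiveSpace emb.n ℂ) 2} (ha : IsRationalClass a) (ha0 : a ≠ 0)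
    (A : HodgeModel (d + 1) X) :
    ∃ ω₀ : complexBetti X (2 + 2 * d), IsRationalClass ω₀ ∧ ω₀ ≠ 0 ∧
      ∀ x : complexBetti X 1, A.pullback 1 x ∈ A.hodgePQ 1 1 0 → x ≠ 0 →
        ∃ t : ℝ, 0 < t ∧
          Complex.I • Motives.polarizationPairingOne X (complexBetti.map emb.ι 2 a) d x
            (conjClass (Motives.ComplexPoints X) 1 x) = (t : ℂ) • ω₀ := by
  classical
  -- ### (0) the model with a natural multiplicative normalised comparison
  obtain ⟨eR, heN, heM, heU⟩ := exists_deRhamIsoFamily_holds A.model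
  let B : HodgeModel (d + 1) X :=
    { A with
      deRham := eR.complexify
      deRham_isNatural := DeRhamIsoFamily.complexify_isNatural heN }
  haveI : CompactSpace A.carrier := by
    haveI := Motives.ComplexPoints.compactSpace_of_isSmoothProjective hX
    exact A.isAnalytification.homeomorph.symm.compactSpace
  haveI : ConnectedSpace A.carrier := A.connectedSpace_carrier hX
  haveI : Nonempty A.carrier := A.nonempty_carrier hX
  letI : MeasurableSpace A.model := borel A.model
  haveI : BorelSpace A.model := ⟨rfl⟩
  haveI : Fact (finrank ℝ A.model = 2 * finrank ℂ A.model) := ⟨finrank_real_of_complex A.model⟩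
  haveI : WedgeFacts 𝓘(ℝ, A.model) A.carrier ℝ :=
    wedgeFacts_of_assoc 𝓘(ℝ, A.model) A.carrier ℝ (ContinuousAlternatingMap.WedgeAssoc_holds ℝ A.model ℝ)
  haveI : WedgeFacts 𝓘(ℝ, A.model) A.carrier ℂ :=
    wedgeFacts_of_assoc 𝓘(ℝ, A.model) A.carrier ℂ (ContinuousAlternatingMap.WedgeAssoc_holds ℝ A.model ℂ)
  have hfin : finrank ℂ A.model = d + 1 := A.isAnalytification.finrank_eq
  have hω : isSmoothForm_kaehlerForm_of_isManifold_complex (E := A.model) (M := A.carrier) :=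
    isSmoothForm_kaehlerForm_of_isManifold_complex_holds
  -- ### (1) the Fubini–Study metric, the hyperplane-type class `H`, the scalar `s`
  haveI := emb.isClosedImmersion
  obtain ⟨g, hg, hform⟩ := A.exists_isKaehler_kaehlerForm_eq_fubiniStudyPullbackForm hX emb.ι
  have hθ := A.fubiniStudyPullbackForm_mem_closedSmoothForms emb.ι
  obtain ⟨H, hH⟩ := B.pullback_surjective 2 (ofRealClass B.carrier 2 (eR B.carrier 2
    (deRhamCohomology.mk ⟨fubiniStudyPullbackForm A.model emb.ι A.toComplexPoints, hθ⟩)))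
  obtain ⟨s, hs0, hsa⟩ := exists_real_map_eq_smul_of_pullback_eq_fubiniStudy hX (Nat.succ_pos d) B emb.ι
    eR heN hθ hH ha ha0
  have hK : B.IsKaehlerClassVia eR H := B.isKaehlerClassVia_of_pullback_eq_fubiniStudyPullbackForm eR hX emb.ι hθ hH
  -- the complexified Kähler class `Θ = B^* H`
  set Θ : singularCohomology ℂ ℂ A.carrier 2 := ofRealClass A.carrier 2 (eR A.carrier 2 (g.kaehlerClass hω hg)) with hΘdef
  have hΘ : B.pullback 2 H = Θ := by
    rw [hH, hΘdef]
    unfold ContMDiffRiemannianMetric.kaehlerClass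
    congr 3
    exact Subtype.ext hform.symm
  -- ### (2) the orientation, normalised by `∫ ω^{d+1} > 0`
  obtain ⟨o₀, ho, hpos⟩ := exists_orientation_integral_kaehlerFormPow_pos g hg.isHermitian
  -- ### (3) the core: `i • Q_{H,d}(x, x̄) = t • L^d_H H`, `t > 0`
  have core : ∀ x : complexBetti X 1, A.pullback 1 x ∈ A.hodgePQ 1 1 0 → x ≠ 0 →
      ∃ t : ℝ, 0 < t ∧ Complex.I • Motives.polarizationPairingOne X H d x (conjClass (Motives.ComplexPoints X) 1 x) =
        (t : ℂ) • lefschetzPow H d 2 H := by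
    intro x hx hx0
    -- move to `B` and pick a closed `(1,0)`-form
    have hxB : B.pullback 1 x ∈ B.hodgePQ 1 1 0 :=
      hodgePQ_independent_of_hodgeModel_holds (d + 1) X hX A B 1 1 0 x hx
    obtain ⟨c, hc, hcx⟩ := Submodule.mem_map.1 hxB
    obtain ⟨αc, htα, rfl⟩ := Motives.exists_isOfType_mk_eq_of_mem_hodgePQ (by norm_num : 1 + 0 = 1) hc
    have hcx' : complexifyFun eR 1 (complexDeRhamCohomology.mk A.model A.carrier 1 αc) = B.pullback 1 x := hcx
    set α : MForm 𝓘(ℝ, A.model) A.carrier ℂ 1 := (αc : MForm 𝓘(ℝ, A.model) A.carrier ℂ 1) with hαdef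
    have hsα : IsSmoothForm α := ((mem_cclosedSmoothForms_iff _).1 αc.2).1
    have hα0 : α ≠ 0 := by
      intro h0
      apply hx0
      apply B.pullback_injective 1
      have hc0 : αc = 0 := Subtype.ext h0
      rw [map_zero, ← hcx', hc0, map_zero]
      exact (eR.complexifyEquiv A.carrier 1).map_zero
    -- degrees
    have h2d : 2 * finrank ℂ A.model = 2 * finrank ℂ A.model := rfl
    have h : 1 + (1 + 2 * d) = 2 * finrank ℂ A.model := by omega
    have hkr : 1 + d = finrank ℂ A.model := by omega
    -- primitivity is automatic in degree one
    have hprim : α.wedge (kaehlerFormPow g.toRiemannianMetric (d + 1)).ofReal = 0 :=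
      mform_eq_zero_of_finrank_lt (by rw [finrank_real_of_complex, hfin]; omega) _
    -- the integral inequality
    have hposΩ : 0 < MForm.integral (fun _ : A.carrier ↦ o₀)
        ((kaehlerFormPow g.toRiemannianMetric (finrank ℂ A.model)).castDeg h2d) := by
      rw [MForm.castDeg_rfl]; exact hpos
    have hint := integral_pos_of_pointwise_of_isOfType (fun _ : A.carrier ↦ o₀) g ho hg.isHermitian
      (p := 1) (q := 0) h2d h hsα hposΩ hprim hα0
      (fun y hy ↦ hodgeRiemann_pointwise g.toRiemannianMetric hg.isHermitian y hkr h2d h α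
        (fun θ v ↦ htα.2 y θ v) hy)
    have hC : Complex.I ^ (((1 : ℕ) : ℤ) - ((0 : ℕ) : ℤ)) * (-1 : ℂ) ^ (1 * (1 - 1) / 2) = Complex.I := by
      norm_num
    rw [hC] at hint
    obtain ⟨hre, him⟩ := hint
    -- closedness of the forms involved
    set γ : MForm 𝓘(ℝ, A.model) A.carrier ℂ (2 * finrank ℂ A.model) :=
      (α.wedge (α.conj.wedge (kaehlerFormPow g.toRiemannianMetric d).ofReal)).castDeg h with hγdef
    have hαcl : α ∈ cclosedSmoothForms A.model A.carrier 1 := αc.2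
    have hαbar : α.conj ∈ cclosedSmoothForms A.model A.carrier 1 := conj_mem_cclosedSmoothForms_holds αc.2
    have hωd : (kaehlerFormPow g.toRiemannianMetric d).ofReal ∈ cclosedSmoothForms A.model A.carrier (2 * d) :=
      ofReal_mem_cclosedSmoothForms (A.kaehlerFormPow_mem_closedSmoothForms g hg d)
    have hiw : α.conj.wedge (kaehlerFormPow g.toRiemannianMetric d).ofReal ∈
        cclosedSmoothForms A.model A.carrier (1 + 2 * d) := wedge_mem_cclosedSmoothForms hαbar hωd
    have how : α.wedge (α.conj.wedge (kaehlerFormPow g.toRiemannianMetric d).ofReal) ∈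
        cclosedSmoothForms A.model A.carrier (1 + (1 + 2 * d)) := wedge_mem_cclosedSmoothForms hαcl hiw
    have hγ : γ ∈ cclosedSmoothForms A.model A.carrier (2 * finrank ℂ A.model) :=
      castDeg_mem_cclosedSmoothForms h how
    set Ω : MForm 𝓘(ℝ, A.model) A.carrier ℝ (2 * finrank ℂ A.model) :=
      kaehlerFormPow g.toRiemannianMetric (finrank ℂ A.model) with hΩdef
    have hΩ : Ω.ofReal ∈ cclosedSmoothForms A.model A.carrier (2 * finrank ℂ A.model) :=
      ofReal_mem_cclosedSmoothForms (A.kaehlerFormPow_mem_closedSmoothForms g hg (finrank ℂ A.model))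
    -- the classes under `eR ⊗ ℂ`
    set u : singularCohomology ℂ ℂ A.carrier 1 := B.pullback 1 x with hudef
    have hubar : complexifyFun eR 1 (complexDeRhamCohomology.mk A.model A.carrier 1 ⟨α.conj, hαbar⟩) =
        conjClass A.carrier 1 u := by
      rw [← hcx', conjClass_complexifyFun, complexDeRhamCohomology.conj_mk]
    have hW : complexifyFun eR (2 * d) (complexDeRhamCohomology.mk A.model A.carrier (2 * d)
        ⟨(kaehlerFormPow g.toRiemannianMetric d).ofReal, hωd⟩) = cupPowTwo Θ d := by
      rw [complexifyFun_mk_ofReal eR ⟨kaehlerFormPow g.toRiemannianMetric d,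
        A.kaehlerFormPow_mem_closedSmoothForms g hg d⟩ hωd]
      exact ofRealClass_kaehlerFormPow_eq_cupPowTwo A eR heM heU hω g hg d
    have hγclass : complexifyFun eR (2 * finrank ℂ A.model)
        (complexDeRhamCohomology.mk A.model A.carrier _ ⟨γ, hγ⟩) =
        cupProduct h u (cupProduct rfl (conjClass A.carrier 1 u) (cupPowTwo Θ d)) := by
      have h1 := complexifyFun_mk_castDeg_wedge heM h ⟨α, hαcl⟩
        ⟨α.conj.wedge (kaehlerFormPow g.toRiemannianMetric d).ofReal, hiw⟩ hγ
      have h2 := complexifyFun_mk_wedge heM ⟨α.conj, hαbar⟩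
        ⟨(kaehlerFormPow g.toRiemannianMetric d).ofReal, hωd⟩
      have hux : complexifyFun eR 1 (complexDeRhamCohomology.mk A.model A.carrier 1 ⟨α, hαcl⟩) = u := hcx'
      rw [h1, hux, ← hubar, ← hW, ← h2]
    have hΩclass : complexifyFun eR (2 * finrank ℂ A.model)
        (complexDeRhamCohomology.mk A.model A.carrier _ ⟨Ω.ofReal, hΩ⟩) = cupPowTwo Θ (finrank ℂ A.model) := by
      rw [complexifyFun_mk_ofReal eR ⟨Ω, A.kaehlerFormPow_mem_closedSmoothForms g hg _⟩ hΩ]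
      exact ofRealClass_kaehlerFormPow_eq_cupPowTwo A eR heM heU hω g hg _
    -- `Θ^{d+1} ≠ 0`, so `[Ω ⊗ 1] ≠ 0`
    have hΘpow : ∀ m : ℕ, m = d + 1 → cupPowTwo Θ m ≠ 0 := by
      rintro m rfl h0
      apply hK.cupPowTwo_ne_zero hX heM (p := d + 1) (by omega) le_rfl
      apply B.pullback_injective (2 * (d + 1))
      rw [map_cupPowTwo, map_zero]
      change cupPowTwo (B.pullback 2 H) (d + 1) = 0
      rw [hΘ]
      exact h0
    have hΩne : complexDeRhamCohomology.mk A.model A.carrier _ ⟨Ω.ofReal, hΩ⟩ ≠ 0 := by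
      intro h0
      apply hΘpow (finrank ℂ A.model) hfin
      rw [← hΩclass, h0]
      exact (eR.complexifyEquiv A.carrier _).map_zero
    -- the top complex de Rham cohomology is a line
    have hline : finrank ℂ (complexDeRhamCohomology A.model A.carrier (2 * finrank ℂ A.model)) = 1 := by
      have h1 : finrank ℂ (complexBetti X (2 * (d + 1))) = 1 := finrank_complexBetti_two_mul_eq_one hX
      rw [← hfin] at h1
      have e1 := (eR.complexifyEquiv A.carrier (2 * finrank ℂ A.model)).finrank_eq
      have e2 := (LinearEquiv.ofBijective (B.pullback (2 * finrank ℂ A.model)).hom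
        ⟨B.pullback_injective _, B.pullback_surjective _⟩).finrank_eq
      rw [e1, ← e2, h1]
    obtain ⟨z, hz⟩ := (finrank_eq_one_iff_of_nonzero' _ hΩne).1 hline
      (complexDeRhamCohomology.mk A.model A.carrier _ ⟨γ, hγ⟩)
    -- integrals
    have hIγ := cintegral_eq_mul_of_mk_eq_smul (fun _ : A.carrier ↦ o₀) ho ⟨γ, hγ⟩ ⟨Ω.ofReal, hΩ⟩ z hz.symm
    have hIΩ : cintegral (fun _ : A.carrier ↦ o₀) (Ω.ofReal) = (MForm.integral (fun _ : A.carrier ↦ o₀) Ω : ℂ) :=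
      cintegral_ofReal _ Ω
    have hV : 0 < MForm.integral (fun _ : A.carrier ↦ o₀) Ω := hpos
    change cintegral (fun _ : A.carrier ↦ o₀) γ = z * cintegral (fun _ : A.carrier ↦ o₀) Ω.ofReal at hIγ
    rw [hIΩ] at hIγ
    -- `I z = t`, a positive real
    set ρ : ℂ := Complex.I * cintegral (fun _ : A.carrier ↦ o₀) γ with hρ
    have hρre : 0 < ρ.re := hre
    have hρim : ρ.im = 0 := him
    have hρeq : ρ = (ρ.re : ℂ) := Complex.ext (by simp) (by simp [hρim])
    set t : ℝ := ρ.re / MForm.integral (fun _ : A.carrier ↦ o₀) Ω with htdef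
    have ht : 0 < t := div_pos hρre hV
    have hIz : Complex.I * z = (t : ℂ) := by
      have hV0 : (MForm.integral (fun _ : A.carrier ↦ o₀) Ω : ℂ) ≠ 0 := Complex.ofReal_ne_zero.2 hV.ne'
      have e1 : Complex.I * z * (MForm.integral (fun _ : A.carrier ↦ o₀) Ω : ℂ) = ρ := by
        rw [hρ, hIγ, mul_assoc]
      rw [htdef, Complex.ofReal_div, eq_div_iff hV0, ← hρeq, e1]
    -- the class identity on the carrier, in degree `2 dim`
    have hcl : Complex.I • cupProduct h u (cupProduct rfl (conjClass A.carrier 1 u) (cupPowTwo Θ d)) =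
        (t : ℂ) • cupPowTwo Θ (finrank ℂ A.model) := by
      rw [← hγclass, ← hΩclass, ← hIz, ← smul_smul, ← complexifyFun_smul, ← complexifyFun_smul,
        ← complexifyFun_smul, hz]
    -- rewrite both sides as Lefschetz iterates, then move to degree `2 + 2d`
    have hΘsucc : ∀ (m : ℕ) (hm : m = d + 1),
        cupPowTwo Θ m = cupProduct (by omega : 2 * d + 2 = 2 * m) (cupPowTwo Θ d) Θ := by
      rintro m rfl
      rfl
    have hs : 2 + 2 * d = 2 * finrank ℂ A.model := by omega
    rw [hΘsucc _ hfin, ← cupProduct_assoc rfl rfl hs h u (conjClass A.carrier 1 u) (cupPowTwo Θ d)] at hcl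
    have hcl' := smul_cupProduct_eq_of_degree_eq hs (by omega) rfl (by omega : 2 * d + 2 = 2 + 2 * d) hcl
    rw [← lefschetzPow_eq_cupProduct_cupPowTwo, ← lefschetzPow_self_eq_cupPowTwo] at hcl'
    -- descend to `X(ℂ)` along the injective `B^*`
    refine ⟨t, ht, B.pullback_injective (2 + 2 * d) ?_⟩
    rw [map_smul, map_smul, polarizationPairingOne_apply]
    rw [HodgeModel.pullback, lefschetzPow_map, lefschetzPow_map, cupProduct_map, ← conjClass_map]
    change Complex.I • lefschetzPow (B.pullback 2 H) d 2 (cupProduct rfl u (conjClass A.carrier 1 u)) =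
      (t : ℂ) • lefschetzPow (B.pullback 2 H) d 2 (B.pullback 2 H)
    rw [hΘ]
    exact hcl'
  -- ### (4) the reference class and the sign of `s`
  have hrat : IsRationalClass (complexBetti.map emb.ι 2 a) := ha.pullback _
  have hLrat : IsRationalClass (lefschetzPow (complexBetti.map emb.ι 2 a) d 2 (complexBetti.map emb.ι 2 a)) :=
    HodgeRiemannDegreeOne.IsRationalClass.lefschetzPow hrat d hrat
  have hLH : lefschetzPow H d 2 H ≠ 0 := by
    rw [lefschetzPow_self_eq_cupPowTwo]
    exact cupProduct_ne_zero_of_degree_eq (two_mul_add_two d) _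
      (hK.cupPowTwo_ne_zero hX heM (p := d + 1) (by omega) le_rfl)
  have hsC : (s : ℂ) ≠ 0 := Complex.ofReal_ne_zero.2 hs0
  have hLs : lefschetzPow (complexBetti.map emb.ι 2 a) d 2 (complexBetti.map emb.ι 2 a) =
      (s : ℂ) ^ (d + 1) • lefschetzPow H d 2 H := by
    rw [hsa, lefschetzPow_smul_self]
  have hLne : lefschetzPow (complexBetti.map emb.ι 2 a) d 2 (complexBetti.map emb.ι 2 a) ≠ 0 := by
    rw [hLs]
    exact smul_ne_zero (pow_ne_zero _ hsC) hLH
  rcases lt_or_gt_of_ne hs0 with hneg | hsp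
  · refine ⟨-lefschetzPow (complexBetti.map emb.ι 2 a) d 2 (complexBetti.map emb.ι 2 a), ?_,
      neg_ne_zero.2 hLne, fun x hx hx0 ↦ ?_⟩
    · have hr := hLrat.zsmul (-1)
      rwa [neg_one_zsmul] at hr
    · obtain ⟨t, ht, hid⟩ := core x hx hx0
      refine ⟨-t / s, div_pos_of_neg_of_neg (neg_neg_of_pos ht) hneg, ?_⟩
      rw [hsa, polarizationPairingOne_smul, smul_comm, hid, lefschetzPow_smul_self, smul_smul,
        smul_neg, ← neg_smul, smul_smul]
      congr 1
      push_cast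
      field_simp
      ring
  · refine ⟨lefschetzPow (complexBetti.map emb.ι 2 a) d 2 (complexBetti.map emb.ι 2 a), hLrat, hLne,
      fun x hx hx0 ↦ ?_⟩
    obtain ⟨t, ht, hid⟩ := core x hx hx0
    refine ⟨t / s, div_pos ht hsp, ?_⟩
    rw [hsa, polarizationPairingOne_smul, smul_comm, hid, lefschetzPow_smul_self, smul_smul, smul_smul]
    congr 1
    push_cast
    field_simp
    ring

/-- **Model-free form**: the same with the Hodge type of `x` read through ANY Hodge model
(`IsOfHodgeType (d+1) X 1 1 0 x`; all models cut out the same `H^{1,0}`,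
`hodgePQ_independent_of_hodgeModel_holds`, and a Hodge model exists, `nonempty_hodgeModel_holds`).
[cite: VoisinHodgeI2002, §6.3.2 Thm. 6.32 and §7.1.2] -/
theorem hodgeRiemann_degreeOne_of_isOfHodgeType {d : ℕ} {X : Motives.SchemeOver ℂ}
    (hX : Motives.IsSmoothProjective (d + 1) X) (emb : Motives.ProjectiveEmbedding X)
    {a : complexBetti (Motives.projectiveSpace emb.n ℂ) 2} (ha : IsRationalClass a) (ha0 : a ≠ 0) :
    ∃ ω₀ : complexBetti X (2 + 2 * d), IsRationalClass ω₀ ∧ ω₀ ≠ 0 ∧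
      ∀ x : complexBetti X 1, IsOfHodgeType (d + 1) X 1 1 0 x → x ≠ 0 →
        ∃ t : ℝ, 0 < t ∧
          Complex.I • Motives.polarizationPairingOne X (complexBetti.map emb.ι 2 a) d x
            (conjClass (Motives.ComplexPoints X) 1 x) = (t : ℂ) • ω₀ := by
  obtain ⟨A⟩ := (nonempty_hodgeModel_holds (n := d + 1) (X := X)).nonempty hX
  obtain ⟨ω₀, h1, h2, h3⟩ := hodgeRiemann_degreeOne hX emb ha ha0 A
  refine ⟨ω₀, h1, h2, fun x hx hx0 ↦ ?_⟩
  obtain ⟨A', hA'⟩ := hx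
  exact h3 x (hodgePQ_independent_of_hodgeModel_holds (d + 1) X hX A' A 1 1 0 x hA') hx0

end Discharge

end Literature.AlgebraicGeometry.HodgeTheory

end
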